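import Mathlib
import Literature.NumberTheory.Irrationality.Brown2016.DinnerParties
import Summits.KontsevichZagierPeriods.Zeta5Search.Families.ConfigurationsEight
import Summits.KontsevichZagierPeriods.Zeta5Search.Families.ConfigurationsNine
import Summits.KontsevichZagierPeriods.Zeta5Search.Families.ConfigurationsNineCompleteA
import HarnessLib
import Summits.KontsevichZagierPeriods.Zeta5Search.Families.ConfigurationsNineCompleteB

/-!
# ζ(5) search — Families: `𝒞₉ ≤ 105`, part C — the last kernel chunks and `𝒞₉ = 105` assembled

HONEST FRAMING: systematic search; no irrationality claim unless certified.

Cell `pub-zeta5`, seat P2 (for `fam-brown9`).  Continues parts A and B: the 14 chunks with `y ∈ {7, 8}`,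
`completeChunk9_all`, and the assembly `complete_reps9` — every convergent seating plan of `9` guests is equivalent (same
configuration, [Brown2016, §3.1]) to one of the 105 plans `reps9`; with `Families/ConfigurationsNine.lean` this is Brown's
printed `𝒞₉ = 105` [Brown2016, App. 2 §10.1, §10.2.5], fully machine-checked (`card_configurations_nine`).
-/

namespace Summit.KontsevichZagierPeriods.Zeta5Search.Families.Configurations

open Literature.NumberTheory.Irrationality.Brown2016

/-! ### The kernel chunks with `y ∈ {7, 8}` -/

set_option maxHeartbeats 4000000 in
/-- Chunk `(y, z) = (7, 1)`. -/
theorem completeChunk9_7_1 : completeChunk9 7 1 = true := by decide +kernel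

set_option maxHeartbeats 4000000 in
/-- Chunk `(y, z) = (7, 2)`. -/
theorem completeChunk9_7_2 : completeChunk9 7 2 = true := by decide +kernel

set_option maxHeartbeats 4000000 in
/-- Chunk `(y, z) = (7, 3)`. -/
theorem completeChunk9_7_3 : completeChunk9 7 3 = true := by decide +kernel

set_option maxHeartbeats 4000000 in
/-- Chunk `(y, z) = (7, 4)`. -/
theorem completeChunk9_7_4 : completeChunk9 7 4 = true := by decide +kernel

set_option maxHeartbeats 4000000 in
/-- Chunk `(y, z) = (7, 5)`. -/
theorem completeChunk9_7_5 : completeChunk9 7 5 = true := by decide +kernel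

set_option maxHeartbeats 4000000 in
/-- Chunk `(y, z) = (7, 6)`. -/
theorem completeChunk9_7_6 : completeChunk9 7 6 = true := by decide +kernel

set_option maxHeartbeats 4000000 in
/-- Chunk `(y, z) = (7, 8)`. -/
theorem completeChunk9_7_8 : completeChunk9 7 8 = true := by decide +kernel

set_option maxHeartbeats 4000000 in
/-- Chunk `(y, z) = (8, 1)`. -/
theorem completeChunk9_8_1 : completeChunk9 8 1 = true := by decide +kernel

set_option maxHeartbeats 4000000 in
/-- Chunk `(y, z) = (8, 2)`. -/
theorem completeChunk9_8_2 : completeChunk9 8 2 = true := by decide +kernel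

set_option maxHeartbeats 4000000 in
/-- Chunk `(y, z) = (8, 3)`. -/
theorem completeChunk9_8_3 : completeChunk9 8 3 = true := by decide +kernel

set_option maxHeartbeats 4000000 in
/-- Chunk `(y, z) = (8, 4)`. -/
theorem completeChunk9_8_4 : completeChunk9 8 4 = true := by decide +kernel

set_option maxHeartbeats 4000000 in
/-- Chunk `(y, z) = (8, 5)`. -/
theorem completeChunk9_8_5 : completeChunk9 8 5 = true := by decide +kernel

set_option maxHeartbeats 4000000 in
/-- Chunk `(y, z) = (8, 6)`. -/
theorem completeChunk9_8_6 : completeChunk9 8 6 = true := by decide +kernel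

set_option maxHeartbeats 4000000 in
/-- Chunk `(y, z) = (8, 7)`. -/
theorem completeChunk9_8_7 : completeChunk9 8 7 = true := by decide +kernel

/-! ### All chunks; assembly -/

/-- All `56` chunks `(y, z)`, `y ≠ z` in `{1,…,8}`. -/
theorem completeChunk9_all (y z : ℕ) (hy : y ∈ List.range' 1 8) (hz : z ∈ (List.range' 1 8).erase y) :
    completeChunk9 y z = true := by
  have e : List.range' 1 8 = [1, 2, 3, 4, 5, 6, 7, 8] := rfl
  rw [e] at hy hz
  simp only [List.mem_cons, List.not_mem_nil, or_false] at hy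
  rcases hy with rfl | rfl | rfl | rfl | rfl | rfl | rfl | rfl
  · have e' : List.erase [1, 2, 3, 4, 5, 6, 7, 8] 1 = [2, 3, 4, 5, 6, 7, 8] := by decide
    rw [e'] at hz
    simp only [List.mem_cons, List.not_mem_nil, or_false] at hz
    rcases hz with rfl | rfl | rfl | rfl | rfl | rfl | rfl
    exacts [completeChunk9_1_2, completeChunk9_1_3, completeChunk9_1_4, completeChunk9_1_5, completeChunk9_1_6, completeChunk9_1_7, completeChunk9_1_8]
  · have e' : List.erase [1, 2, 3, 4, 5, 6, 7, 8] 2 = [1, 3, 4, 5, 6, 7, 8] := by decide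
    rw [e'] at hz
    simp only [List.mem_cons, List.not_mem_nil, or_false] at hz
    rcases hz with rfl | rfl | rfl | rfl | rfl | rfl | rfl
    exacts [completeChunk9_2_1, completeChunk9_2_3, completeChunk9_2_4, completeChunk9_2_5, completeChunk9_2_6, completeChunk9_2_7, completeChunk9_2_8]
  · have e' : List.erase [1, 2, 3, 4, 5, 6, 7, 8] 3 = [1, 2, 4, 5, 6, 7, 8] := by decide
    rw [e'] at hz
    simp only [List.mem_cons, List.not_mem_nil, or_false] at hz
    rcases hz with rfl | rfl | rfl | rfl | rfl | rfl | rfl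
    exacts [completeChunk9_3_1, completeChunk9_3_2, completeChunk9_3_4, completeChunk9_3_5, completeChunk9_3_6, completeChunk9_3_7, completeChunk9_3_8]
  · have e' : List.erase [1, 2, 3, 4, 5, 6, 7, 8] 4 = [1, 2, 3, 5, 6, 7, 8] := by decide
    rw [e'] at hz
    simp only [List.mem_cons, List.not_mem_nil, or_false] at hz
    rcases hz with rfl | rfl | rfl | rfl | rfl | rfl | rfl
    exacts [completeChunk9_4_1, completeChunk9_4_2, completeChunk9_4_3, completeChunk9_4_5, completeChunk9_4_6, completeChunk9_4_7, completeChunk9_4_8]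
  · have e' : List.erase [1, 2, 3, 4, 5, 6, 7, 8] 5 = [1, 2, 3, 4, 6, 7, 8] := by decide
    rw [e'] at hz
    simp only [List.mem_cons, List.not_mem_nil, or_false] at hz
    rcases hz with rfl | rfl | rfl | rfl | rfl | rfl | rfl
    exacts [completeChunk9_5_1, completeChunk9_5_2, completeChunk9_5_3, completeChunk9_5_4, completeChunk9_5_6, completeChunk9_5_7, completeChunk9_5_8]
  · have e' : List.erase [1, 2, 3, 4, 5, 6, 7, 8] 6 = [1, 2, 3, 4, 5, 7, 8] := by decide
    rw [e'] at hz
    simp only [List.mem_cons, List.not_mem_nil, or_false] at hz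
    rcases hz with rfl | rfl | rfl | rfl | rfl | rfl | rfl
    exacts [completeChunk9_6_1, completeChunk9_6_2, completeChunk9_6_3, completeChunk9_6_4, completeChunk9_6_5, completeChunk9_6_7, completeChunk9_6_8]
  · have e' : List.erase [1, 2, 3, 4, 5, 6, 7, 8] 7 = [1, 2, 3, 4, 5, 6, 8] := by decide
    rw [e'] at hz
    simp only [List.mem_cons, List.not_mem_nil, or_false] at hz
    rcases hz with rfl | rfl | rfl | rfl | rfl | rfl | rfl
    exacts [completeChunk9_7_1, completeChunk9_7_2, completeChunk9_7_3, completeChunk9_7_4, completeChunk9_7_5, completeChunk9_7_6, completeChunk9_7_8]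
  · have e' : List.erase [1, 2, 3, 4, 5, 6, 7, 8] 8 = [1, 2, 3, 4, 5, 6, 7] := by decide
    rw [e'] at hz
    simp only [List.mem_cons, List.not_mem_nil, or_false] at hz
    rcases hz with rfl | rfl | rfl | rfl | rfl | rfl | rfl
    exacts [completeChunk9_8_1, completeChunk9_8_2, completeChunk9_8_3, completeChunk9_8_4, completeChunk9_8_5, completeChunk9_8_6, completeChunk9_8_7]

/-- **Completeness for `N = 9`** (`𝒞₉ ≤ 105`): every convergent seating plan of `9` guests is equivalent to one of the
105 plans `reps9`. [Brown2016, App. 2 §10.1 (table: `𝒞₉ = 105`), §10.2.5] -/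
theorem complete_reps9 :
    ∀ σ, IsSeating 9 σ → IsConvergent 9 σ → ∃ τ ∈ reps9, Equivalent 9 σ τ := by
  intro σ hσ hc
  have hlen : σ.length = 9 := by simpa using hσ.length_eq
  have h9 : 9 ∈ σ := hσ.symm.subset (by decide)
  obtain ⟨r0, hr0, hget⟩ := List.mem_iff_getElem.1 h9
  set σ' := σ.rotate r0 with hσ'
  have hhead : σ'.head? = some 9 := by
    rw [hσ', List.head?_rotate hr0, List.getElem?_eq_getElem hr0]
    exact congrArg some hget
  obtain ⟨rest, hrest⟩ : ∃ rest, σ' = 9 :: rest := by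
    cases hs : σ' with
    | nil => rw [hs] at hhead; simp at hhead
    | cons x rest => rw [hs] at hhead; simp at hhead; exact ⟨rest, by rw [hhead]⟩
  have hperm' : List.Perm σ' (List.range' 1 9) := (List.rotate_perm σ r0).trans hσ
  rw [hrest] at hperm'
  have hrest_perm : List.Perm rest ((List.range' 1 9).erase 9) := (List.cons_perm_iff_perm_erase.1 hperm').2
  have e8 : (List.range' 1 9).erase 9 = List.range' 1 8 := by decide
  rw [e8] at hrest_perm
  -- peel the second guest `y`
  obtain ⟨y, rest1, rfl⟩ : ∃ y rest1, rest = y :: rest1 := by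
    cases rest with
    | nil => exact absurd hrest_perm.length_eq (by decide)
    | cons y rest1 => exact ⟨y, rest1, rfl⟩
  have hy : y ∈ List.range' 1 8 := hrest_perm.subset List.mem_cons_self
  have hrest1 : List.Perm rest1 ((List.range' 1 8).erase y) := (List.cons_perm_iff_perm_erase.1 hrest_perm).2
  -- peel the third guest `z`
  obtain ⟨z, rest2, rfl⟩ : ∃ z rest2, rest1 = z :: rest2 := by
    cases rest1 with
    | nil =>
      have := hrest1.length_eq
      rw [List.length_erase_of_mem hy] at this
      exact absurd this (by simp)
    | cons z rest2 => exact ⟨z, rest2, rfl⟩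
  have hz : z ∈ (List.range' 1 8).erase y := hrest1.subset List.mem_cons_self
  have hrest2 : rest2 ∈ (((List.range' 1 8).erase y).erase z).permutations' :=
    List.mem_permutations'.2 (List.cons_perm_iff_perm_erase.1 hrest1).2
  -- the chunk certificate
  have hchunk := completeChunk9_all y z hy hz
  unfold completeChunk9 at hchunk
  rw [List.all_eq_true] at hchunk
  have h := hchunk rest2 hrest2
  rw [Bool.or_eq_true, Bool.or_eq_true, Bool.not_eq_true'] at h
  have hc' : isConvergent 9 (9 :: y :: z :: rest2) = true := by
    rw [← hrest, hσ', isConvergent_rotate σ hlen r0]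
    exact hc
  rcases h with (h | h) | h
  · have hl9 : (9 :: y :: z :: rest2).length = 9 := by simpa using hperm'.length_eq
    have := isConvergent_false_of_badAdj9 hl9 h
    rw [hc'] at this
    exact absurd this (by decide)
  · obtain ⟨τ, hτ, hστ⟩ := exists_of_findRep9 h
    refine ⟨τ, hτ, ?_⟩
    have h1 : equiv 9 σ' τ = true := by
      rw [hrest]; exact equiv_of_equivFast (by norm_num) hστ
    exact equiv_of_equiv_rotate hlen (by norm_num) r0 h1
  · exact absurd hc' (by simp [h])

/-- **`𝒞₉ = 105`** [Brown2016, App. 2 §10.1 table; §10.2.5] fully machine-checked: the 105 listed plans are convergent,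
pairwise inequivalent, and every convergent plan of `9` guests is equivalent to one of them. -/
theorem card_configurations_nine :
    (∀ σ ∈ reps9, IsConvergent 9 σ) ∧ (reps9.Pairwise fun σ τ => ¬ Equivalent 9 σ τ) ∧ reps9.length = 105 ∧
      ∀ σ, IsSeating 9 σ → IsConvergent 9 σ → ∃ τ ∈ reps9, Equivalent 9 σ τ :=
  ⟨isConvergent_reps9, pairwise_not_equivalent_reps9, rfl, complete_reps9⟩

end Summit.KontsevichZagierPeriods.Zeta5Search.Families.Configurations
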